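import Mathlib.MeasureTheory.Integral.Bochner.Basic
import Mathlib.Analysis.SpecialFunctions.Exponential
import Literature.MathematicalPhysics.StatisticalMechanics.BarlowStackingEnergy
import Literature.MathematicalPhysics.StatisticalMechanics.LennardJonesClusters
import Literature.MathematicalPhysics.StatisticalMechanics.OneCrossingMixture
import Literature.MathematicalPhysics.StatisticalMechanics.LocalLimitOfGroundStates

/-!
# Sketch — crux-ideate stmt-AtomisticToContinuum-11779 (PeriodicGivenLayered), ideator 2, round 1

First lemmas of the two idea cards, stated over existing declarations (no new notions):

* card `alternating-majorisation-one-crossing`: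
  `AlternatingMajorisation` (pure combinatorics of Hägg words: the alternating word minimises
  `haggLocalEnergy J · m` POINTWISE for every non-positive coupling sequence that is non-decreasing
  from `k = 2` on, with deficit `≥ (J 3 - J 2)` at every non-`ABA` layer),
  `OneCrossingTransport` (the three-line total-positivity lemma),
  `RegistrySignAntitone` (its Lennard-Jones instance on the relaxation box: the registry coupling
  `H ↦ barlowCoupling lennardJones a H 1` is `≤ 0` and non-decreasing on `[39a/25, ∞)`),
  `PerFaultGainFreeSpacings` (the consequence used by the crux: at ARBITRARY admissible spacings
  every stacking fault costs `≥ 3·10⁻⁵` against the alternating word at the same spacings).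
* card `recurrent-limit-density-closing`:
  `WindowSiteEnergyBound` (one-sided cut-and-paste bound for windows of finite ground states),
  `IncrementConvexity` (uniform convexity of the alternating block energy in the layer increments).
-/

namespace Summit.AtomisticToContinuum.Crystallization.Cruxes.PeriodicGivenLayered.IdeatorTwo

open scoped BigOperators
open MeasureTheory Set Filter Finset
open Literature.MathematicalPhysics.StatisticalMechanics

/-- Card A, first lemma (combinatorial core, potential-free). For couplings `J k ≤ 0` (`k ≥ 2`)
with `J 2 ≤ J 3 ≤ J 4 ≤ ⋯` (attractive on-top registry, weakening with the layer distance) and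
ANY Hägg word `s`, the forward registry energy of layer `m` is at least that of the alternating
word, with a deficit `≥ J 3 - J 2 ≥ 0` whenever layers `m`, `m+2` are not aligned (a fault at `m`).
Proof idea: the set `S = {k ≥ 1 : aligned(m,k)}` never contains `1` nor two consecutive integers,
so `#(S ∩ [1,K]) ≤ ⌊K/2⌋ = #{even k ≤ K}` for every `K`; Abel summation with the antitone weights
`w_k = -J k`, or directly the Bétermin–Petrache pairing `(2j, 2j+1)`. PROVED: `MajorisationProof.lean`,
`haggLocalEnergy_alternating_add_deficit_le` / `alternatingMajorisation_holds`, axioms standard. -/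
def AlternatingMajorisation : Prop :=
  ∀ (J : ℕ → ℝ) (s : ℤ → ℤ), IsHaggSeq s → Summable J → (∀ k, 2 ≤ k → J k ≤ 0) →
    (∀ k, 2 ≤ k → J k ≤ J (k + 1)) → ∀ m : ℤ,
      haggLocalEnergy J alternatingHagg m + (J 3 - J 2) * (if HaggAligned s m 2 then 0 else 1)
        ≤ haggLocalEnergy J s m

/-- Card A, the transport lemma (total positivity of the Laplace kernel, three lines): if `g ≥ 0`
and `w` changes sign once at `t₀` (from `≤ 0` to `≥ 0`), then
`s ↦ e^{t₀ s} ∫_0^∞ g(t) w(t) e^{-t s} dt` is non-increasing on `(0, ∞)`; in particular the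
transform changes sign at most once, from `+` to `-`, as `s` increases. PROVED (no differentiation
needed): `OneCrossingProof.lean`, `oneCrossingTransport`, axioms standard. -/
def OneCrossingTransport : Prop :=
  ∀ (g w : ℝ → ℝ) (t₀ : ℝ), 0 < t₀ → (∀ t, 0 < t → 0 ≤ g t) → (∀ t ∈ Set.Ioo 0 t₀, w t ≤ 0) →
    (∀ t, t₀ ≤ t → 0 ≤ w t) →
    (∀ s : ℝ, 0 < s → IntegrableOn (fun t => g t * w t * Real.exp (-(t * s))) (Set.Ioi 0)) →
    AntitoneOn (fun s : ℝ => Real.exp (t₀ * s) * ∫ t in Set.Ioi 0, g t * w t * Real.exp (-(t * s)))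
      (Set.Ioi 0)

/-- Card A, Lennard-Jones instance (the ONLY potential-specific input of the line; two certified
point inequalities + `OneCrossingTransport`). On the relaxation box `a ∈ [47/50, 1]` the registry
coupling of a triangular layer at height `H`, `D_a(H) = Φ_A(H) - Φ_N(H) = barlowCoupling lennardJones a H 1`,
is non-positive and non-decreasing (its modulus non-increasing) for `H ≥ 39a/25`, the smallest
height of a second-neighbour layer in the box. Numerics (uncertified, theta/Poisson quadrature,
this session): sign crossover at `H/a ∈ [1.101, 1.207]`, monotonicity crossover at
`H/a ∈ [1.187, 1.296]`, both `< 1.56`; point ratios at `H = 1.56a`, `a = 0.94`: `0.365` and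
`0.465` (`< 1` needed). -/
def RegistrySignAntitone : Prop :=
  ∀ a : ℝ, 47 / 50 ≤ a → a ≤ 1 → ∀ H H' : ℝ, 39 / 25 * a ≤ H → H ≤ H' →
    barlowCoupling lennardJones a H' 1 ≤ 0 ∧
      barlowCoupling lennardJones a H 1 ≤ barlowCoupling lennardJones a H' 1

/-- Card A, the statement the crux consumes: at ARBITRARY admissible layer heights `z` (increments
in `[39a/50, 17a/20]`, the format of `LayeredWindows` / `PeriodicGivenLayered`) and for every Hägg
word, the forward registry energy of every layer exceeds that of the alternating word AT THE SAME
HEIGHTS by at least `3·10⁻⁵` per stacking fault (numerics: `w₂ - w₃ ≥ 3.67·10⁻⁵` at the worst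
corner `a = 1`, `H₂ = 1.7a`, `H₃ = 2.34a`). Follows from `AlternatingMajorisation` applied to the
site-dependent couplings `k ↦ D_a(z (m+k) - z m)` and `RegistrySignAntitone`. -/
def PerFaultGainFreeSpacings : Prop :=
  ∀ a : ℝ, 47 / 50 ≤ a → a ≤ 1 → ∀ z : ℤ → ℝ,
    (∀ m : ℤ, 39 / 50 * a ≤ z (m + 1) - z m ∧ z (m + 1) - z m ≤ 17 / 20 * a) →
    ∀ s : ℤ → ℤ, IsHaggSeq s → ∀ m : ℤ,
      haggLocalEnergy (fun k => barlowCoupling lennardJones a (z (m + k) - z m) 1) alternatingHagg m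
          + 3 / 100000 * (if HaggAligned s m 2 then 0 else 1)
        ≤ haggLocalEnergy (fun k => barlowCoupling lennardJones a (z (m + k) - z m) 1) s m

/-- Card C, first lemma (one-sided cut-and-paste, finite `N`, existing declarations only): the site
energies of the particles of a Lennard-Jones ground state inside any ball of radius `R` sum to at
most `2 E(#window) + C R²` (remove the window, place an optimal `#window`-cluster far away; the
crossing attraction is a boundary-layer term by the uniform minimal distance). With
`CrysEnergyLimit` (proved) this is the density bound "windows of local limits have mean site energy
`≤ 2e* + o(1)`" that the recurrence argument consumes. -/
def WindowSiteEnergyBound : Prop :=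
  ∃ C : ℝ, ∀ (N : ℕ) (x : Fin N → EuclideanSpace ℝ (Fin 3)), IsGroundState lennardJones x →
    ∀ (t : EuclideanSpace ℝ (Fin 3)) (R : ℝ), 1 ≤ R →
      ∑ i ∈ Finset.univ.filter (fun i => ‖x i + t‖ ≤ R), siteEnergy lennardJones x i
        ≤ 2 * groundStateEnergy lennardJones 3 (Finset.univ.filter (fun i => ‖x i + t‖ ≤ R)).card
          + C * R ^ 2

/-- The energy of a finite alternating (`ABAB…`) stack of `n + 1` triangular layers of spacing `a`
with layer increments `Δ 0, …, Δ (n-1)`, counted as the sum over ordered pairs of layers `i < j` of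
the interaction of one site of layer `i` with the whole layer `j` (aligned iff `j - i` is even). -/
noncomputable def altBlockEnergy (a : ℝ) (n : ℕ) (Δ : Fin n → ℝ) : ℝ :=
  ∑ i ∈ Finset.range n, ∑ j ∈ Finset.Ioc i n,
    layerInteraction lennardJones a (∑ l ∈ Finset.Ico i j, if h : l < n then Δ ⟨l, h⟩ else 0)
      (if Even (j - i) then 0 else 1) 1

/-- Card C, spacing rigidity input: the alternating block energy is UNIFORMLY CONVEX in the layer
increments on the box, uniformly in the block length (diagonal dominance of the interlayer Hessian:
numerics `Φ_N'' ≥ 6.5` on `[0.78a, 0.85a]` against `Σ_{k≥2} k² sup|Φ_k''| ≤ 2.1`, margin `≥ 3`).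
With recurrence + Jensen this forces constant increments in a recurrent alternating local limit. -/
def IncrementConvexity : Prop :=
  ∃ κ : ℝ, 0 < κ ∧ ∀ a : ℝ, 47 / 50 ≤ a → a ≤ 1 → ∀ (n : ℕ) (Δ Δ' : Fin n → ℝ),
    (∀ i, 39 / 50 * a ≤ Δ i ∧ Δ i ≤ 17 / 20 * a) → (∀ i, 39 / 50 * a ≤ Δ' i ∧ Δ' i ≤ 17 / 20 * a) →
      κ * ∑ i, (Δ i - Δ' i) ^ 2
        ≤ altBlockEnergy a n Δ + altBlockEnergy a n Δ' - 2 * altBlockEnergy a n (fun i => (Δ i + Δ' i) / 2)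

/- The crux decl these lemmas serve (not imported here, to keep this file independent of the route
module's build state): `Summit.AtomisticToContinuum.Crystallization.Theses.PhononSlackCertificates.PeriodicGivenLayered`
(= `…Theses.HullMinimality.PeriodicGivenLayered`, item stmt-AtomisticToContinuum-11779). -/

end Summit.AtomisticToContinuum.Crystallization.Cruxes.PeriodicGivenLayered.IdeatorTwo
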